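import Literature.NumberTheory.EllipticCurves.Gamma0RankinSelbergResidue
import Literature.Analysis.Complex.HolomorphicParametricIntegral
import HarnessLib

/-!
# Holomorphy in `s` of Rankin–Selberg integrals over a fundamental domain of finite index

Topic `Literature/NumberTheory/EllipticCurves`; namespace
`Literature.NumberTheory.EllipticCurves.ModularForms`. Theorems only; no definition, no named fact.

The analytic step of the Rankin–Selberg method that carries an unfolded identity from its
half-plane of absolute convergence to the point of interest: the integral over the domain
`F = ⋃_q g_q⁻¹ 𝒟ᵒ` (finitely many `SL(2, ℤ)`-translates of the open fundamental domain, as in the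
tree's `Gamma0RankinSelbergUnfolding`) of a kernel

`K(s, τ) = \overline{E(τ, s̄)} · φ(τ) \overline{F(τ)} (Im τ)²`

is holomorphic in `s` on an open, conjugation-stable set `U`, provided

* `φ` is a weight-`2` cusp form of arithmetic level (exponential decay at *every* cusp),
* `F` is measurable with `|F(τ)| (Im τ)^{1/2} ≤ C (v^A + v^{-A})`, `v = Im(g_q τ)`, on each piece
  (moderate growth at every cusp, weight-one normalisation),
* `E(τ, ·)` is holomorphic on `U`, `E(·, s)` is measurable on the domain, and
  `|E(τ, s̄)| (Im τ)^{1/2} ≤ C (v^A + v^{-A})` on each piece, locally uniformly in `s`.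

Indeed `|K| = (|φ| y)(|F| y^{1/2})(|E| y^{1/2}) ≤ C e^{-cv} v (v^{A}+v^{-A})(v^{A'}+v^{-A'})` is then
*bounded* on each piece, locally uniformly in `s` (`exists_bound_exp_neg_mul_growth`), the domain has
finite hyperbolic volume (`volume_domain_lt_top`), and dominated holomorphic parametric integrals
are holomorphic (`Literature.Analysis.Complex.differentiableOn_integral_of_dominated`, here in the
form `differentiableOn_setIntegral_of_locally_bounded`).

Main statements:

* `volume_setOf_smul_mem_fd`, `volume_setOf_smul_mem_fdo_lt_top`, `volume_domain_lt_top`;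
* `differentiableOn_setIntegral_of_locally_bounded` — holomorphy of `s ↦ ∫_S K(s, x) dμ` for a
  finite-measure `S`, `K(·, x)` holomorphic, `K(s, ·)` measurable, `|K| ≤ C` near each `s₀`;
* `rpow_add_rpow_neg_le`, `rpow_le_two_pow_mul_pow`, `exp_neg_mul_mul_pow_le`,
  `exists_bound_exp_neg_mul_growth` — the elementary growth bookkeeping on `v ≥ 1/2`;
* `exists_norm_mul_im_le_exp_neg`, `exists_norm_mul_im_le_exp_neg_of_smul_mem` — **uniform
  exponential decay of a weight-`2` cusp form at the cusp `g⁻¹∞`**: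
  `|φ(g⁻¹σ)| Im(g⁻¹σ) ≤ C e^{-c Im σ} Im σ` for `Im σ ≥ 1/2` (Mathlib `CuspForm.translate`,
  `CuspFormClass.exp_decay_atImInfty'` made explicit by the tree's `exists_norm_le_exp_neg`, and the
  Petersson bound `CuspFormClass.petersson_bounded_left` below height `A`);
* `differentiableOn_integral_domain_rsKernel` — **the holomorphy theorem** above.

This is the input `(A4c)` for evaluating at `s = 0` the weight-`(2, 1)` Rankin–Selberg identity of
`RankinSelbergWeightOneUnfolding` with Hecke's continued weight-one Eisenstein series (Rankin 1939,
§4; Shimura 1976, §2). Everything is proved. [folklore]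

## References

* R. A. Rankin, Proc. Cambridge Philos. Soc. 35 (1939), 357–372, §4 (Thm. 3).
* G. Shimura, *The special values of the zeta functions associated with cusp forms*, Comm. Pure
  Appl. Math. 29 (1976), §2.
-/

noncomputable section

open scoped MatrixGroups ModularForm Modular Real Topology ENNReal NNReal ComplexConjugate Nat
open UpperHalfPlane hiding I
open MeasureTheory Set Filter Metric ModularGroup ConjAct Pointwise CongruenceSubgroup Complex

namespace Literature.NumberTheory.EllipticCurves.ModularForms

/-! ### Finite volume of the pieces and of the domain -/

section Volume

/-- `vol {τ | s τ ∈ 𝒟} = vol 𝒟` (invariance of the hyperbolic measure). [folklore] -/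
theorem volume_setOf_smul_mem_fd (s : SL(2, ℤ)) : volume {τ : ℍ | s • τ ∈ 𝒟} = volume 𝒟 := by
  have h := setLIntegral_fd_comp_inv_smul s (fun _ => 1)
  simp only [lintegral_const, MeasurableSet.univ, Measure.restrict_apply, univ_inter, one_mul] at h
  exact h.symm

/-- Each piece `{τ | s τ ∈ 𝒟ᵒ}` has finite hyperbolic volume. [folklore] -/
theorem volume_setOf_smul_mem_fdo_lt_top (s : SL(2, ℤ)) : volume {τ : ℍ | s • τ ∈ 𝒟ᵒ} < ∞ :=
  calc volume {τ : ℍ | s • τ ∈ 𝒟ᵒ} ≤ volume {τ : ℍ | s • τ ∈ 𝒟} :=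
        measure_mono fun _ hτ => fdo_subset_fd hτ
    _ = volume 𝒟 := volume_setOf_smul_mem_fd s
    _ < ∞ := volume_fd_lt_top

variable {ι : Type*} [Fintype ι] (g : ι → SL(2, ℤ))

/-- **The domain `⋃_q g_q⁻¹ 𝒟ᵒ` has finite hyperbolic volume** (finitely many pieces of volume at most
`vol 𝒟 < ∞`). [folklore] -/
theorem volume_domain_lt_top : volume (⋃ i, {τ : ℍ | g i • τ ∈ 𝒟ᵒ}) < ∞ := by
  refine (measure_iUnion_le _).trans_lt ?_
  rw [tsum_fintype]
  exact ENNReal.sum_lt_top.mpr fun i _ => volume_setOf_smul_mem_fdo_lt_top (g i)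

end Volume

/-! ### Holomorphy of set integrals with locally uniform sup bounds -/

section SetIntegral

/-- **Holomorphy of `s ↦ ∫_S K(s, x) dμ` for a bounded holomorphic kernel on a finite-measure set**:
if `μ S < ∞`, each `K(·, x)` is holomorphic on the open `U`, each `K(s, ·)` (`s ∈ U`) is
a.e.-strongly measurable on `S`, and every `s₀ ∈ U` has a ball on which `|K(s, x)| ≤ C` for all
`x ∈ S`, then the set integral is holomorphic on `U` (dominated holomorphic parametric integrals,
`Literature.Analysis.Complex.differentiableOn_integral_of_dominated`, with a constant dominating
function). [folklore] -/
theorem differentiableOn_setIntegral_of_locally_bounded {X : Type*} [MeasurableSpace X]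
    {μ : Measure X} {S : Set X} (hSm : MeasurableSet S) (hμS : μ S ≠ ∞) {K : ℂ → X → ℂ}
    {U : Set ℂ} (hU : IsOpen U) (hdiff : ∀ x, DifferentiableOn ℂ (fun s => K s x) U)
    (hmeas : ∀ s ∈ U, AEStronglyMeasurable (K s) (μ.restrict S))
    (hbd : ∀ s₀ ∈ U, ∃ ε > 0, ∃ C : ℝ, ∀ s ∈ ball s₀ ε, ∀ x ∈ S, ‖K s x‖ ≤ C) :
    DifferentiableOn ℂ (fun s => ∫ x in S, K s x ∂μ) U := by
  haveI : IsFiniteMeasure (μ.restrict S) := isFiniteMeasure_restrict.mpr hμS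
  refine Literature.Analysis.Complex.differentiableOn_integral_of_dominated (μ := μ.restrict S)
    (F := K) hmeas (ae_of_all _ fun x => hdiff x) fun s₀ hs₀ => ?_
  obtain ⟨ε, hε, C, hC⟩ := hbd s₀ hs₀
  obtain ⟨ρ, hρ, hρU⟩ := Metric.isOpen_iff.mp hU s₀ hs₀
  refine ⟨min ε ρ, lt_min hε hρ, (ball_subset_ball (min_le_right _ _)).trans hρU,
    fun _ => C, integrable_const C, ?_⟩
  rw [ae_restrict_iff' hSm]
  exact ae_of_all _ fun x hx s hs => hC s (ball_subset_ball (min_le_left _ _) hs) x hx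

end SetIntegral

/-! ### Elementary growth bookkeeping on `v ≥ 1/2` -/

section Growth

/-- `v^A + v^{-A} ≤ 2 · 4^{|A|} v^{|A|}` for `v ≥ 1/2`. [folklore] -/
theorem rpow_add_rpow_neg_le {v : ℝ} (hv : 1 / 2 ≤ v) (A : ℝ) :
    v ^ A + v ^ (-A) ≤ 2 * 4 ^ |A| * v ^ |A| := by
  have hv0 : 0 < v := by linarith
  have key : ∀ B : ℝ, 0 ≤ B → v ^ B + v ^ (-B) ≤ 2 * 4 ^ B * v ^ B := by
    intro B hB
    have h2v : 1 ≤ 2 * v := by linarith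
    have h1 : v ^ (-B) ≤ 2 ^ B := by
      rw [Real.rpow_neg hv0.le, ← Real.inv_rpow hv0.le]
      refine Real.rpow_le_rpow (inv_nonneg.mpr hv0.le) ?_ hB
      rw [inv_le_comm₀ hv0 two_pos]
      linarith
    have h2 : (1 : ℝ) ≤ (2 * v) ^ B := Real.one_le_rpow h2v hB
    have h4 : (4 : ℝ) ^ B * v ^ B = 2 ^ B * (2 * v) ^ B := by
      rw [Real.mul_rpow two_pos.le hv0.le, show (4 : ℝ) = 2 * 2 by norm_num,
        Real.mul_rpow two_pos.le two_pos.le]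
      ring
    have h3 : v ^ B ≤ 4 ^ B * v ^ B :=
      le_mul_of_one_le_left (Real.rpow_nonneg hv0.le B) (Real.one_le_rpow (by norm_num) hB)
    have h5 : v ^ (-B) ≤ 4 ^ B * v ^ B := by
      rw [h4]
      calc v ^ (-B) ≤ 2 ^ B := h1
        _ = 2 ^ B * 1 := (mul_one _).symm
        _ ≤ 2 ^ B * (2 * v) ^ B :=
            mul_le_mul_of_nonneg_left h2 (Real.rpow_nonneg (by norm_num) B)
    linarith
  rcases le_or_gt 0 A with hA | hA
  · rw [abs_of_nonneg hA]
    exact key A hA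
  · rw [abs_of_neg hA]
    have h := key (-A) (by linarith)
    rw [neg_neg] at h
    linarith

/-- `v^B ≤ 2ⁿ vⁿ` for `v ≥ 1/2` and `0 ≤ B ≤ n`. [folklore] -/
theorem rpow_le_two_pow_mul_pow {v : ℝ} (hv : 1 / 2 ≤ v) {B : ℝ} (hB : 0 ≤ B) {n : ℕ}
    (hBn : B ≤ n) : v ^ B ≤ 2 ^ n * v ^ n := by
  have hv0 : 0 < v := by linarith
  have h2v : 1 ≤ 2 * v := by linarith
  have h1 : v ^ B ≤ (2 * v) ^ B := Real.rpow_le_rpow hv0.le (by linarith) hB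
  have h2 : (2 * v) ^ B ≤ (2 * v) ^ (n : ℝ) := Real.rpow_le_rpow_of_exponent_le h2v hBn
  rw [Real.rpow_natCast, mul_pow] at h2
  exact h1.trans h2

/-- `e^{-cv} vⁿ ≤ n!/cⁿ` for `c > 0`, `v ≥ 0` (Mathlib `Real.pow_div_factorial_le_exp`). [folklore] -/
theorem exp_neg_mul_mul_pow_le {c : ℝ} (hc : 0 < c) {v : ℝ} (hv : 0 ≤ v) (n : ℕ) :
    Real.exp (-c * v) * v ^ n ≤ n ! / c ^ n := by
  have h := Real.pow_div_factorial_le_exp (c * v) (by positivity) n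
  rw [div_le_iff₀ (by positivity), mul_pow] at h
  rw [le_div_iff₀ (by positivity)]
  calc Real.exp (-c * v) * v ^ n * c ^ n = Real.exp (-c * v) * (c ^ n * v ^ n) := by ring
    _ ≤ Real.exp (-c * v) * (Real.exp (c * v) * n !) :=
        mul_le_mul_of_nonneg_left h (Real.exp_pos _).le
    _ = n ! := by
        rw [← mul_assoc, ← Real.exp_add, show -c * v + c * v = 0 by ring, Real.exp_zero, one_mul]

/-- **The product `e^{-cv} v (v^A + v^{-A})(v^B + v^{-B})` is bounded on `v ≥ 1/2`** (`c > 0`).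
[folklore] -/
theorem exists_bound_exp_neg_mul_growth {c : ℝ} (hc : 0 < c) (A B : ℝ) :
    ∃ M : ℝ, 0 ≤ M ∧ ∀ v : ℝ, 1 / 2 ≤ v →
      Real.exp (-c * v) * v * ((v ^ A + v ^ (-A)) * (v ^ B + v ^ (-B))) ≤ M := by
  set a : ℝ := |A| + |B| with ha
  have ha0 : 0 ≤ a := by positivity
  obtain ⟨n, hn⟩ := exists_nat_ge (1 + a)
  refine ⟨4 * 4 ^ a * (2 ^ n * (n ! / c ^ n)), by positivity, fun v hv => ?_⟩
  have hv0 : 0 < v := by linarith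
  have hA := rpow_add_rpow_neg_le hv A
  have hB := rpow_add_rpow_neg_le hv B
  have hprod : (v ^ A + v ^ (-A)) * (v ^ B + v ^ (-B)) ≤ 4 * 4 ^ a * v ^ a := by
    calc (v ^ A + v ^ (-A)) * (v ^ B + v ^ (-B))
        ≤ (2 * 4 ^ |A| * v ^ |A|) * (2 * 4 ^ |B| * v ^ |B|) :=
          mul_le_mul hA hB (by positivity) (by positivity)
      _ = 4 * (4 ^ |A| * 4 ^ |B|) * (v ^ |A| * v ^ |B|) := by ring
      _ = 4 * 4 ^ a * v ^ a := by
          rw [← Real.rpow_add (by norm_num), ← Real.rpow_add hv0]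
  have hva : v * v ^ a ≤ 2 ^ n * v ^ n := by
    have h1 : v * v ^ a = v ^ (1 + a) := by rw [Real.rpow_add hv0 1 a, Real.rpow_one]
    rw [h1]
    exact rpow_le_two_pow_mul_pow hv (by positivity) hn
  have hexp := exp_neg_mul_mul_pow_le hc hv0.le n
  have he0 : 0 ≤ Real.exp (-c * v) := (Real.exp_pos _).le
  calc Real.exp (-c * v) * v * ((v ^ A + v ^ (-A)) * (v ^ B + v ^ (-B)))
      ≤ Real.exp (-c * v) * v * (4 * 4 ^ a * v ^ a) :=
        mul_le_mul_of_nonneg_left hprod (by positivity)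
    _ = 4 * 4 ^ a * (Real.exp (-c * v) * (v * v ^ a)) := by ring
    _ ≤ 4 * 4 ^ a * (Real.exp (-c * v) * (2 ^ n * v ^ n)) := by gcongr
    _ = 4 * 4 ^ a * (2 ^ n * (Real.exp (-c * v) * v ^ n)) := by ring
    _ ≤ 4 * 4 ^ a * (2 ^ n * (n ! / c ^ n)) := by gcongr

end Growth

/-! ### The kernel and cusp forms at the other cusps -/

section Kernel

/-- `|ē · (p f̄ y²)| = (|p| y)(|f| √y)(|e| √y)` for `y ≥ 0`: the weight-`(2, 1, 1)` splitting of the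
Rankin–Selberg kernel. [folklore] -/
theorem norm_rsKernel_eq (e p f : ℂ) {y : ℝ} (hy : 0 ≤ y) :
    ‖conj e * (p * conj f * ((y : ℂ)) ^ 2)‖ =
      (‖p‖ * y) * (‖f‖ * Real.sqrt y) * (‖e‖ * Real.sqrt y) := by
  rw [norm_mul, norm_mul, norm_mul, Complex.norm_conj, Complex.norm_conj, norm_pow,
    Complex.norm_real, Real.norm_of_nonneg hy]
  have h : Real.sqrt y * Real.sqrt y = y := Real.mul_self_sqrt hy
  calc ‖e‖ * (‖p‖ * ‖f‖ * y ^ 2) = ‖p‖ * y * (‖f‖ * ‖e‖) * (Real.sqrt y * Real.sqrt y) := by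
        rw [h]; ring
    _ = (‖p‖ * y) * (‖f‖ * Real.sqrt y) * (‖e‖ * Real.sqrt y) := by ring

variable {Γ : Subgroup (GL (Fin 2) ℝ)} [Γ.IsArithmetic]

/-- **Uniform exponential decay of a weight-`2` cusp form at the cusp `g⁻¹∞`**: for `φ ∈ S₂(Γ)`,
`Γ` arithmetic, and `g ∈ SL(2, ℤ)` there are `C ≥ 0`, `c > 0` with
`|φ(g⁻¹σ)| Im(g⁻¹σ) ≤ C e^{-c Im σ} Im σ` whenever `Im σ ≥ 1/2` (`|φ(g⁻¹σ)| Im(g⁻¹σ) = |φ∣g⁻¹(σ)| Im σ`;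
the translated cusp form decays exponentially above some height `A` and is `O(1/Im σ)` below it).
[folklore] -/
theorem exists_norm_mul_im_le_exp_neg (f : CuspForm Γ 2) (g : SL(2, ℤ)) :
    ∃ C c : ℝ, 0 < c ∧ 0 ≤ C ∧ ∀ σ : ℍ, 1 / 2 ≤ σ.im →
      ‖f (g⁻¹ • σ)‖ * (g⁻¹ • σ).im ≤ C * Real.exp (-c * σ.im) * σ.im := by
  set b : GL (Fin 2) ℝ := Matrix.SpecialLinearGroup.mapGL ℝ g with hb
  have hbmem : b ∈ 𝒮ℒ := ⟨g, rfl⟩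
  haveI := isArithmetic_conj_of_mem_SL Γ (inv_mem hbmem)
  set f' := CuspForm.translate f b⁻¹ with hf'
  have hcoe : (⇑f' : ℍ → ℂ) = ⇑f ∣[(2 : ℤ)] g⁻¹ := by
    rw [hf', coe_cuspForm_translate, hb, ← map_inv, ModularForm.SL_slash]
    rfl
  -- the Petersson weight is translated into that of `f'`
  have hpt : ∀ σ : ℍ, ‖f (g⁻¹ • σ)‖ * (g⁻¹ • σ).im = ‖f' σ‖ * σ.im := by
    intro σ
    have h := UpperHalfPlane.petersson_slash_SL 2 ⇑f ⇑f g⁻¹ σ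
    rw [← hcoe, petersson_self_eq_ofReal, petersson_self_eq_ofReal] at h
    have h2 : ‖f' σ‖ ^ 2 * σ.im ^ 2 = ‖f (g⁻¹ • σ)‖ ^ 2 * (g⁻¹ • σ).im ^ 2 := by
      exact_mod_cast h
    have h3 : (‖f' σ‖ * σ.im) ^ 2 = (‖f (g⁻¹ • σ)‖ * (g⁻¹ • σ).im) ^ 2 := by
      rw [mul_pow, mul_pow]; exact h2
    exact ((sq_eq_sq₀ (by positivity) (by positivity)).mp h3).symm
  -- exponential decay above height `A`, Petersson bound everywhere
  obtain ⟨C, c, A, hc, hC, hdec⟩ := exists_norm_le_exp_neg f'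
  obtain ⟨B, hB⟩ := CuspFormClass.petersson_bounded_left 2 _ f' f'
  have hB' : ∀ z : ℍ, ‖f' z‖ ^ 2 * z.im ^ 2 ≤ B := fun z ↦ by
    have h := hB z
    rw [petersson_self_eq_ofReal, Complex.norm_real, Real.norm_of_nonneg (by positivity)] at h
    exact_mod_cast h
  have hB0 : 0 ≤ B := le_trans (by positivity) (hB' UpperHalfPlane.I)
  have hB'' : ∀ z : ℍ, ‖f' z‖ * z.im ≤ Real.sqrt B := fun z ↦ by
    have h1 : (‖f' z‖ * z.im) ^ 2 ≤ B := by rw [mul_pow]; exact hB' z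
    have h2 := Real.sqrt_le_sqrt h1
    rwa [Real.sqrt_sq (by positivity)] at h2
  set A' : ℝ := max A 0 with hA'
  refine ⟨C + 2 * Real.sqrt B * Real.exp (c * A'), c, hc, by positivity, fun σ hσ => ?_⟩
  rw [hpt σ]
  have hσ0 : 0 < σ.im := σ.im_pos
  have he0 : 0 < Real.exp (-c * σ.im) := Real.exp_pos _
  by_cases hcase : A ≤ σ.im
  · -- large height: exponential decay
    calc ‖f' σ‖ * σ.im ≤ C * Real.exp (-c * σ.im) * σ.im :=
          mul_le_mul_of_nonneg_right (hdec σ hcase) hσ0.le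
      _ ≤ (C + 2 * Real.sqrt B * Real.exp (c * A')) * Real.exp (-c * σ.im) * σ.im := by
          have : 0 ≤ 2 * Real.sqrt B * Real.exp (c * A') := by positivity
          gcongr
          linarith
  · -- small height: Petersson bound, and `e^{cA'} e^{-c Im σ} Im σ ≥ 1/2`
    push Not at hcase
    have hle : σ.im ≤ A' := hcase.le.trans (le_max_left _ _)
    have h1 : (1 : ℝ) ≤ Real.exp (c * A') * Real.exp (-c * σ.im) := by
      rw [← Real.exp_add]
      exact Real.one_le_exp (by nlinarith)
    have h2 : Real.sqrt B ≤ 2 * Real.sqrt B * Real.exp (c * A') * Real.exp (-c * σ.im) * σ.im := by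
      have hs : 0 ≤ Real.sqrt B := Real.sqrt_nonneg B
      have : Real.sqrt B * 1 ≤ Real.sqrt B * ((Real.exp (c * A') * Real.exp (-c * σ.im)) * (2 * σ.im)) :=
        mul_le_mul_of_nonneg_left (one_le_mul_of_one_le_of_one_le h1 (by linarith)) hs
      linarith [this]
    calc ‖f' σ‖ * σ.im ≤ Real.sqrt B := hB'' σ
      _ ≤ 2 * Real.sqrt B * Real.exp (c * A') * Real.exp (-c * σ.im) * σ.im := h2
      _ ≤ (C + 2 * Real.sqrt B * Real.exp (c * A')) * Real.exp (-c * σ.im) * σ.im := by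
          have h3 : 0 ≤ C * Real.exp (-c * σ.im) * σ.im := by positivity
          nlinarith [h3]

/-- The same decay on the piece `{τ | g τ ∈ 𝒟ᵒ}` written in the variable `τ = g⁻¹σ`:
`|φ(τ)| Im τ ≤ C e^{-c Im(gτ)} Im(gτ)` whenever `Im(gτ) ≥ 1/2`. [folklore] -/
theorem exists_norm_mul_im_le_exp_neg_of_smul (f : CuspForm Γ 2) (g : SL(2, ℤ)) :
    ∃ C c : ℝ, 0 < c ∧ 0 ≤ C ∧ ∀ τ : ℍ, 1 / 2 ≤ (g • τ).im →
      ‖f τ‖ * τ.im ≤ C * Real.exp (-c * (g • τ).im) * (g • τ).im := by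
  obtain ⟨C, c, hc, hC, h⟩ := exists_norm_mul_im_le_exp_neg f g
  refine ⟨C, c, hc, hC, fun τ hτ => ?_⟩
  have h' := h (g • τ) hτ
  rwa [inv_smul_smul] at h'

end Kernel

/-! ### Holomorphy of the Rankin–Selberg integral over the domain -/

section Holomorphy

variable {ι : Type*} [Fintype ι] (g : ι → SL(2, ℤ))
variable {Γ : Subgroup (GL (Fin 2) ℝ)} [Γ.IsArithmetic]

/-- **Holomorphy in `s` of `∫_F \overline{E(τ, s̄)} φ(τ) \overline{F(τ)} (Im τ)² dμ`** over the domain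
`F = ⋃_q g_q⁻¹ 𝒟ᵒ`, for a weight-`2` cusp form `φ` of arithmetic level, a measurable `F` of
moderate growth `|F| y^{1/2} ≤ C (v^A + v^{-A})` (`v = Im(g_q τ)`) on each piece, and a kernel `E`
holomorphic in `s ∈ U` (`U` open and stable under conjugation), measurable in `τ` on the domain,
with `|E(τ, s̄)| y^{1/2} ≤ C (v^A + v^{-A})` on each piece locally uniformly in `s`: the integrand
is then bounded on the finite-volume domain, locally uniformly in `s`. [folklore] -/
theorem differentiableOn_integral_domain_rsKernel (f : CuspForm Γ 2) {F : ℍ → ℂ}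
    (hFm : Measurable F)
    (hF : ∀ i, ∃ C A : ℝ, ∀ τ : ℍ, g i • τ ∈ 𝒟ᵒ →
      ‖F τ‖ * Real.sqrt τ.im ≤ C * ((g i • τ).im ^ A + (g i • τ).im ^ (-A)))
    {E : ℍ → ℂ → ℂ} {U : Set ℂ} (hU : IsOpen U) (hUc : ∀ s ∈ U, conj s ∈ U)
    (hEd : ∀ τ, DifferentiableOn ℂ (E τ) U)
    (hEm : ∀ s ∈ U, AEStronglyMeasurable (fun τ => E τ s)
      (volume.restrict (⋃ i, {τ : ℍ | g i • τ ∈ 𝒟ᵒ})))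
    (hEb : ∀ s₀ ∈ U, ∀ i, ∃ ε > 0, ∃ C A : ℝ, ∀ s ∈ ball s₀ ε, ∀ τ : ℍ, g i • τ ∈ 𝒟ᵒ →
      ‖E τ (conj s)‖ * Real.sqrt τ.im ≤ C * ((g i • τ).im ^ A + (g i • τ).im ^ (-A))) :
    DifferentiableOn ℂ (fun s => ∫ τ in ⋃ i, {τ : ℍ | g i • τ ∈ 𝒟ᵒ},
      conj (E τ (conj s)) * (f τ * conj (F τ) * ((τ.im : ℝ) : ℂ) ^ 2)) U := by
  have hSm : MeasurableSet (⋃ i, {τ : ℍ | g i • τ ∈ 𝒟ᵒ}) :=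
    MeasurableSet.iUnion fun i => (isOpen_setOf_smul_mem_fdo (g i)).measurableSet
  refine differentiableOn_setIntegral_of_locally_bounded hSm (volume_domain_lt_top g).ne hU
    (fun τ => ?_) (fun s hs => ?_) (fun s₀ hs₀ => ?_)
  · -- holomorphy in `s`
    intro s hs
    have hcs : conj s ∈ U := hUc s hs
    have hd : DifferentiableAt ℂ (E τ) (conj s) :=
      (hEd τ _ hcs).differentiableAt (hU.mem_nhds hcs)
    have h2 : DifferentiableAt ℂ (conj ∘ E τ ∘ conj) s := by
      have h := hd.conj_conj
      rwa [Complex.conj_conj] at h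
    exact (h2.mul_const _).differentiableWithinAt
  · -- measurability in `τ`
    have h1 : AEStronglyMeasurable (fun τ => conj (E τ (conj s)))
        (volume.restrict (⋃ i, {τ : ℍ | g i • τ ∈ 𝒟ᵒ})) :=
      Complex.continuous_conj.comp_aestronglyMeasurable (hEm _ (hUc s hs))
    have hφm : Measurable (⇑f : ℍ → ℂ) := (ModularFormClass.holo f).continuous.measurable
    have h2 : Measurable fun τ : ℍ => f τ * conj (F τ) * ((τ.im : ℝ) : ℂ) ^ 2 :=
      (hφm.mul (Complex.continuous_conj.measurable.comp hFm)).mul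
        ((Complex.measurable_ofReal.comp UpperHalfPlane.continuous_im.measurable).pow_const _)
    exact h1.mul h2.aestronglyMeasurable
  · -- locally uniform bound on the domain
    rcases isEmpty_or_nonempty ι with hι | hι
    · refine ⟨1, one_pos, 0, fun s _ τ hτ => ?_⟩
      simp only [mem_iUnion] at hτ
      obtain ⟨i, _⟩ := hτ
      exact (IsEmpty.false i).elim
    choose Cφ cφ hcφ hCφ hφb using fun i => exists_norm_mul_im_le_exp_neg_of_smul f (g i)
    choose CF AF hFb using hF
    choose ε hε CE AE hEb' using hEb s₀ hs₀
    choose M hM0 hM using fun i => exists_bound_exp_neg_mul_growth (hcφ i) (AF i) (AE i)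
    set ε₀ : ℝ := Finset.univ.inf' Finset.univ_nonempty ε with hε₀
    have hε₀pos : 0 < ε₀ := (Finset.lt_inf'_iff _).mpr fun i _ => hε i
    have hε₀le : ∀ i, ε₀ ≤ ε i := fun i => Finset.inf'_le _ (Finset.mem_univ i)
    refine ⟨ε₀, hε₀pos, ∑ j, Cφ j * |CF j| * |CE j| * M j, fun s hs τ hτ => ?_⟩
    obtain ⟨i, hi⟩ := mem_iUnion.mp hτ
    have hi' : g i • τ ∈ 𝒟ᵒ := hi
    set v : ℝ := (g i • τ).im with hv
    have hvhalf : 1 / 2 ≤ v := (half_lt_im_of_mem_fdo hi').le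
    have hv0 : 0 < v := by linarith
    have hy0 : 0 ≤ τ.im := τ.im_pos.le
    have h1 : ‖f τ‖ * τ.im ≤ Cφ i * Real.exp (-cφ i * v) * v := hφb i τ hvhalf
    have hpow0 : ∀ A : ℝ, 0 ≤ v ^ A + v ^ (-A) := fun A => by positivity
    have h2 : ‖F τ‖ * Real.sqrt τ.im ≤ |CF i| * (v ^ AF i + v ^ (-AF i)) :=
      (hFb i τ hi').trans (mul_le_mul_of_nonneg_right (le_abs_self _) (hpow0 _))
    have hs' : s ∈ ball s₀ (ε i) := ball_subset_ball (hε₀le i) hs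
    have h3 : ‖E τ (conj s)‖ * Real.sqrt τ.im ≤ |CE i| * (v ^ AE i + v ^ (-AE i)) :=
      (hEb' i s hs' τ hi').trans (mul_le_mul_of_nonneg_right (le_abs_self _) (hpow0 _))
    have hCφ0 : 0 ≤ Cφ i * Real.exp (-cφ i * v) * v := by
      have := hCφ i
      positivity
    calc ‖conj (E τ (conj s)) * (f τ * conj (F τ) * ((τ.im : ℝ) : ℂ) ^ 2)‖
        = (‖f τ‖ * τ.im) * (‖F τ‖ * Real.sqrt τ.im) * (‖E τ (conj s)‖ * Real.sqrt τ.im) :=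
          norm_rsKernel_eq _ _ _ hy0
      _ ≤ (Cφ i * Real.exp (-cφ i * v) * v) * (|CF i| * (v ^ AF i + v ^ (-AF i))) *
            (|CE i| * (v ^ AE i + v ^ (-AE i))) := by
          apply mul_le_mul (mul_le_mul h1 h2 (by positivity) hCφ0) h3 (by positivity)
          exact mul_nonneg hCφ0 (mul_nonneg (abs_nonneg _) (hpow0 _))
      _ = Cφ i * |CF i| * |CE i| *
            (Real.exp (-cφ i * v) * v * ((v ^ AF i + v ^ (-AF i)) * (v ^ AE i + v ^ (-AE i)))) := by
          ring
      _ ≤ Cφ i * |CF i| * |CE i| * M i := by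
          have := hCφ i
          exact mul_le_mul_of_nonneg_left (hM i v hvhalf) (by positivity)
      _ ≤ ∑ j, Cφ j * |CF j| * |CE j| * M j := by
          refine Finset.single_le_sum (f := fun j => Cφ j * |CF j| * |CE j| * M j)
            (fun j _ => ?_) (Finset.mem_univ i)
          have := hCφ j
          have := hM0 j
          positivity

end Holomorphy

end Literature.NumberTheory.EllipticCurves.ModularForms
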